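import Summits.QuantumFields.YangMills.Theorems.FemtoTransferGapPositivityGram
import HarnessLib

/-!
# (C5-split) THE FOUR-PIECE SPLIT OF THE hOD DEFECT: `∫ E²w ≤ 2·I_core + 2·I_tail + 2·I_out + 2·I_B`
# (lane A of S-BASE, crux `TwistedTraceScaling` stmt-QuantumFields-20203, C4-CORE, the (OD) pen; `pub/ym-fleet/ym-luscher-20007-p1/HANDOFF-g20.md`)

Abstract measure theory behind the assembly of the field `hOD` of `RecordAnalyticInput` from its pieces (`…BODefect.hOD_of_defect` wants ONE defect
`E = 𝟙_S·(F/w − B)` with `∫ E²w ≤ (bΛ)²·T`).  On a finite measure space, with `S_in ⊆ S` measurable, `w > 0` on `S`, `F = K_c + K_t` on `S_in` (the core/tail split of the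
transfer of the BO function, `…BODefectTailFP.transferApply_boFun_eq_core_add_tail`), and all data bounded measurable:
* §1 `integrable_indicator_mul_of_bound` — `𝟙_A·g` is integrable once `|g| ≤ C` on `A`;
* §2 `sq_defect_split_pointwise` — `𝟙_S(F/w − B)²w ≤ 2·𝟙_{S_in}(K_c/w − B)²w + 2·𝟙_{S_in}K_t²/w + 2·𝟙_{S∖S_in}F²/w + 2·𝟙_{S∖S_in}B²w`;
* §3 ★★ `sq_integral_defect_split_le` — the same integrated;
* §4 ★★ `defect_bound_of_pieces` — if the four integrals are `≤ (b_iΛ)²T` then `∫ (𝟙_S(F/w − B))²w ≤ (√(2(b₁²+b₂²+b₃²+b₄²))·Λ)²·T`;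
  `rate_small_of_pieces` — `b_i² = o(λ)` (in the `∀ a > 0, ∀ᶠ` form of `RecordAnalyticInput.hb_small`) for `i = 1..4` ⇒ the same for `b = √(2Σb_i²)`.
HONEST FRAMING: bookkeeping for a stub of a child of the CONDITIONAL route R2b1; the pieces (C5) and the hOD assembly, (B-ST), C4-CORE OPEN; not a gap, not Clay.
-/

set_option autoImplicit false

noncomputable section

open MeasureTheory Filter Topology Real
open scoped BigOperators

namespace Summit.QuantumFields.YangMills.Theorems.FemtoTransferGap.TwoLattice.ConstTube

open Summit.QuantumFields.YangMills.Theorems.FemtoTransferGap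

section Abstract

variable {X : Type*} [MeasurableSpace X] (μ : Measure X) [IsFiniteMeasure μ]

/-! ## §1 Integrability of truncated bounded data -/

/-- `𝟙_A·g` is integrable on a finite measure space once `g` is measurable and `|g| ≤ C` on the measurable set `A`. [folklore] -/
theorem integrable_indicator_mul_of_bound {A : Set X} (hA : MeasurableSet A) {g : X → ℝ} (hg : Measurable g) {C : ℝ} (hC : ∀ x ∈ A, |g x| ≤ C) :
    Integrable (fun x => A.indicator (fun _ => (1 : ℝ)) x * g x) μ := by
  refine integrable_of_measurable_abs_le μ ((measurable_const.indicator hA).mul hg) (C := max C 0) fun x => ?_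
  by_cases hx : x ∈ A
  · rw [Set.indicator_of_mem hx, one_mul]; exact (hC x hx).trans (le_max_left _ _)
  · rw [Set.indicator_of_notMem hx, zero_mul, abs_zero]; exact le_max_right _ _

/-! ## §2 The pointwise split -/

omit [MeasurableSpace X] in
/-- **Pointwise four-piece split** of the squared weighted defect (see the module docstring). [folklore] -/
theorem sq_defect_split_pointwise {F Kc Kt B w : X → ℝ} {S Sin : Set X} (hsub : Sin ⊆ S) (hw : ∀ x ∈ S, 0 < w x) (hsplit : ∀ x ∈ Sin, F x = Kc x + Kt x)
    (x : X) :
    (S.indicator (fun x => F x / w x - B x) x) ^ 2 * w x ≤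
      2 * (Sin.indicator (fun _ => (1 : ℝ)) x * ((Kc x / w x - B x) ^ 2 * w x)) + 2 * (Sin.indicator (fun _ => (1 : ℝ)) x * (Kt x ^ 2 / w x)) +
        2 * ((S \ Sin).indicator (fun _ => (1 : ℝ)) x * (F x ^ 2 / w x)) + 2 * ((S \ Sin).indicator (fun _ => (1 : ℝ)) x * (B x ^ 2 * w x)) := by
  by_cases hxS : x ∈ S
  · have hwx : 0 < w x := hw x hxS
    rw [Set.indicator_of_mem hxS]
    by_cases hxin : x ∈ Sin
    · have hxout : x ∉ S \ Sin := fun h => h.2 hxin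
      rw [Set.indicator_of_mem hxin, Set.indicator_of_notMem hxout, hsplit x hxin]
      simp only [one_mul, zero_mul, mul_zero, add_zero]
      have e : ((Kc x + Kt x) / w x - B x) ^ 2 * w x = ((Kc x / w x - B x) + Kt x / w x) ^ 2 * w x := by rw [add_div]; ring
      rw [e]
      have key : ((Kc x / w x - B x) + Kt x / w x) ^ 2 ≤ 2 * (Kc x / w x - B x) ^ 2 + 2 * (Kt x / w x) ^ 2 := by
        nlinarith [sq_nonneg ((Kc x / w x - B x) - Kt x / w x)]
      have e2 : Kt x ^ 2 / w x = (Kt x / w x) ^ 2 * w x := by field_simp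
      rw [e2]
      nlinarith [mul_le_mul_of_nonneg_right key hwx.le]
    · have hxout : x ∈ S \ Sin := ⟨hxS, hxin⟩
      rw [Set.indicator_of_notMem hxin, Set.indicator_of_mem hxout]
      simp only [one_mul, zero_mul, mul_zero, zero_add]
      have key : (F x / w x - B x) ^ 2 ≤ 2 * (F x / w x) ^ 2 + 2 * B x ^ 2 := by nlinarith [sq_nonneg (F x / w x + B x)]
      have e2 : F x ^ 2 / w x = (F x / w x) ^ 2 * w x := by field_simp
      rw [e2]
      nlinarith [mul_le_mul_of_nonneg_right key hwx.le]
  · have hxin : x ∉ Sin := fun h => hxS (hsub h)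
    have hxout : x ∉ S \ Sin := fun h => hxS h.1
    rw [Set.indicator_of_notMem hxS, Set.indicator_of_notMem hxin, Set.indicator_of_notMem hxout]
    simp

/-! ## §3 ★★ The integrated split -/

/-- ★★ **THE FOUR-PIECE SPLIT, INTEGRATED.**  `S_in ⊆ S` measurable, `w ≥ w₀ > 0` on `S`, `F = K_c + K_t` on `S_in`, all data bounded measurable:
`∫ (𝟙_S(F/w − B))²w ≤ 2∫𝟙_{S_in}(K_c/w − B)²w + 2∫𝟙_{S_in}K_t²/w + 2∫𝟙_{S∖S_in}F²/w + 2∫𝟙_{S∖S_in}B²w`. [folklore] -/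
theorem sq_integral_defect_split_le {F Kc Kt B w : X → ℝ} (hF : Measurable F) (hKc : Measurable Kc) (hKt : Measurable Kt) (hB : Measurable B) (hwm : Measurable w)
    {CF CKc CKt CB Cw : ℝ} (hCF : ∀ x, |F x| ≤ CF) (hCKc : ∀ x, |Kc x| ≤ CKc) (hCKt : ∀ x, |Kt x| ≤ CKt) (hCB : ∀ x, |B x| ≤ CB) (hCw : ∀ x, |w x| ≤ Cw)
    {S Sin : Set X} (hS : MeasurableSet S) (hSin : MeasurableSet Sin) (hsub : Sin ⊆ S) {w₀ : ℝ} (hw₀ : 0 < w₀) (hwS : ∀ x ∈ S, w₀ ≤ w x)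
    (hsplit : ∀ x ∈ Sin, F x = Kc x + Kt x) :
    ∫ x, (S.indicator (fun x => F x / w x - B x) x) ^ 2 * w x ∂μ ≤
      2 * ∫ x, Sin.indicator (fun _ => (1 : ℝ)) x * ((Kc x / w x - B x) ^ 2 * w x) ∂μ + 2 * ∫ x, Sin.indicator (fun _ => (1 : ℝ)) x * (Kt x ^ 2 / w x) ∂μ +
        2 * ∫ x, (S \ Sin).indicator (fun _ => (1 : ℝ)) x * (F x ^ 2 / w x) ∂μ + 2 * ∫ x, (S \ Sin).indicator (fun _ => (1 : ℝ)) x * (B x ^ 2 * w x) ∂μ := by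
  have hw : ∀ x ∈ S, 0 < w x := fun x hx => hw₀.trans_le (hwS x hx)
  -- integrability of the four pieces
  have i1 : Integrable (fun x => Sin.indicator (fun _ => (1 : ℝ)) x * ((Kc x / w x - B x) ^ 2 * w x)) μ := by
    refine integrable_indicator_mul_of_bound μ hSin ((((hKc.div hwm).sub hB).pow_const 2).mul hwm) (C := (CKc / w₀ + CB) ^ 2 * Cw) fun x hx => ?_
    have hwx := hw x (hsub hx)
    have h0Kc : 0 ≤ CKc := (abs_nonneg _).trans (hCKc x)
    have h1 : |Kc x / w x - B x| ≤ CKc / w₀ + CB := by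
      refine (abs_sub _ _).trans (add_le_add ?_ (hCB x))
      rw [abs_div, abs_of_pos hwx]
      exact div_le_div₀ h0Kc (hCKc x) hw₀ (hwS x (hsub hx))
    rw [abs_mul, abs_of_pos hwx, abs_pow]
    have hCw' : w x ≤ Cw := (le_abs_self _).trans (hCw x)
    have h10 : 0 ≤ CKc / w₀ + CB := (abs_nonneg _).trans h1
    exact mul_le_mul (pow_le_pow_left₀ (abs_nonneg _) h1 2) hCw' hwx.le (pow_nonneg h10 2)
  have i2 : Integrable (fun x => Sin.indicator (fun _ => (1 : ℝ)) x * (Kt x ^ 2 / w x)) μ := by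
    refine integrable_indicator_mul_of_bound μ hSin ((hKt.pow_const 2).div hwm) (C := CKt ^ 2 / w₀) fun x hx => ?_
    have hwx := hw x (hsub hx)
    rw [abs_div, abs_of_pos hwx, abs_pow]
    exact div_le_div₀ (sq_nonneg _) (pow_le_pow_left₀ (abs_nonneg _) (hCKt x) 2) hw₀ (hwS x (hsub hx))
  have i3 : Integrable (fun x => (S \ Sin).indicator (fun _ => (1 : ℝ)) x * (F x ^ 2 / w x)) μ := by
    refine integrable_indicator_mul_of_bound μ (hS.diff hSin) ((hF.pow_const 2).div hwm) (C := CF ^ 2 / w₀) fun x hx => ?_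
    have hwx := hw x hx.1
    rw [abs_div, abs_of_pos hwx, abs_pow]
    exact div_le_div₀ (sq_nonneg _) (pow_le_pow_left₀ (abs_nonneg _) (hCF x) 2) hw₀ (hwS x hx.1)
  have i4 : Integrable (fun x => (S \ Sin).indicator (fun _ => (1 : ℝ)) x * (B x ^ 2 * w x)) μ := by
    refine integrable_indicator_mul_of_bound μ (hS.diff hSin) ((hB.pow_const 2).mul hwm) (C := CB ^ 2 * Cw) fun x hx => ?_
    have hwx := hw x hx.1
    rw [abs_mul, abs_of_pos hwx, abs_pow]
    exact mul_le_mul (pow_le_pow_left₀ (abs_nonneg _) (hCB x) 2) ((le_abs_self _).trans (hCw x)) hwx.le (sq_nonneg _)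
  have hpt := fun x => sq_defect_split_pointwise (B := B) hsub hw hsplit x
  have hnn : ∀ x, 0 ≤ (S.indicator (fun x => F x / w x - B x) x) ^ 2 * w x := fun x => by
    by_cases hx : x ∈ S
    · exact mul_nonneg (sq_nonneg _) (hw x hx).le
    · rw [Set.indicator_of_notMem hx]; simp
  have i12 : Integrable (fun x => 2 * (Sin.indicator (fun _ => (1 : ℝ)) x * ((Kc x / w x - B x) ^ 2 * w x)) + 2 * (Sin.indicator (fun _ => (1 : ℝ)) x * (Kt x ^ 2 / w x))) μ :=
    (i1.const_mul 2).add (i2.const_mul 2)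
  have i123 : Integrable (fun x => 2 * (Sin.indicator (fun _ => (1 : ℝ)) x * ((Kc x / w x - B x) ^ 2 * w x)) + 2 * (Sin.indicator (fun _ => (1 : ℝ)) x * (Kt x ^ 2 / w x)) +
      2 * ((S \ Sin).indicator (fun _ => (1 : ℝ)) x * (F x ^ 2 / w x))) μ := i12.add (i3.const_mul 2)
  have hint : Integrable (fun x => 2 * (Sin.indicator (fun _ => (1 : ℝ)) x * ((Kc x / w x - B x) ^ 2 * w x)) + 2 * (Sin.indicator (fun _ => (1 : ℝ)) x * (Kt x ^ 2 / w x)) +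
      2 * ((S \ Sin).indicator (fun _ => (1 : ℝ)) x * (F x ^ 2 / w x)) + 2 * ((S \ Sin).indicator (fun _ => (1 : ℝ)) x * (B x ^ 2 * w x))) μ := i123.add (i4.const_mul 2)
  calc ∫ x, (S.indicator (fun x => F x / w x - B x) x) ^ 2 * w x ∂μ
      ≤ ∫ x, 2 * (Sin.indicator (fun _ => (1 : ℝ)) x * ((Kc x / w x - B x) ^ 2 * w x)) + 2 * (Sin.indicator (fun _ => (1 : ℝ)) x * (Kt x ^ 2 / w x)) +
          2 * ((S \ Sin).indicator (fun _ => (1 : ℝ)) x * (F x ^ 2 / w x)) + 2 * ((S \ Sin).indicator (fun _ => (1 : ℝ)) x * (B x ^ 2 * w x)) ∂μ :=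
        integral_mono_of_nonneg (ae_of_all _ hnn) hint (ae_of_all _ hpt)
    _ = _ := by
        rw [integral_add i123 (i4.const_mul 2), integral_add i12 (i3.const_mul 2), integral_add (i1.const_mul 2) (i2.const_mul 2),
          integral_const_mul, integral_const_mul, integral_const_mul, integral_const_mul]

/-! ## §4 ★★ From the pieces to one rate -/

omit [MeasurableSpace X] in
/-- ★★ **ONE RATE FROM FOUR**: `I ≤ 2I₁ + 2I₂ + 2I₃ + 2I₄` and `I_i ≤ (b_iΛ)²T` give `I ≤ (√(2(b₁²+b₂²+b₃²+b₄²))·Λ)²·T`. [folklore] -/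
theorem defect_bound_of_pieces {I I₁ I₂ I₃ I₄ T Λ b₁ b₂ b₃ b₄ : ℝ} (hI : I ≤ 2 * I₁ + 2 * I₂ + 2 * I₃ + 2 * I₄)
    (h₁ : I₁ ≤ (b₁ * Λ) ^ 2 * T) (h₂ : I₂ ≤ (b₂ * Λ) ^ 2 * T) (h₃ : I₃ ≤ (b₃ * Λ) ^ 2 * T) (h₄ : I₄ ≤ (b₄ * Λ) ^ 2 * T) :
    I ≤ (Real.sqrt (2 * (b₁ ^ 2 + b₂ ^ 2 + b₃ ^ 2 + b₄ ^ 2)) * Λ) ^ 2 * T := by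
  rw [mul_pow, Real.sq_sqrt (by positivity)]
  nlinarith

omit [MeasurableSpace X] in
/-- `√(2(b₁²+b₂²+b₃²+b₄²)) ≥ 0`. [folklore] -/
theorem rate_of_pieces_nonneg (b₁ b₂ b₃ b₄ : ℝ) : 0 ≤ Real.sqrt (2 * (b₁ ^ 2 + b₂ ^ 2 + b₃ ^ 2 + b₄ ^ 2)) := Real.sqrt_nonneg _

omit [MeasurableSpace X] in
/-- **The combined rate is small when the pieces are** (the `∀ a > 0, ∀ᶠ β, b β² ≤ a·λ β` form of `RecordAnalyticInput.hb_small`). [folklore] -/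
theorem rate_small_of_pieces {lam b₁ b₂ b₃ b₄ : ℝ → ℝ}
    (h₁ : ∀ a : ℝ, 0 < a → ∀ᶠ β in atTop, b₁ β ^ 2 ≤ a * lam β) (h₂ : ∀ a : ℝ, 0 < a → ∀ᶠ β in atTop, b₂ β ^ 2 ≤ a * lam β)
    (h₃ : ∀ a : ℝ, 0 < a → ∀ᶠ β in atTop, b₃ β ^ 2 ≤ a * lam β) (h₄ : ∀ a : ℝ, 0 < a → ∀ᶠ β in atTop, b₄ β ^ 2 ≤ a * lam β) :
    ∀ a : ℝ, 0 < a → ∀ᶠ β in atTop, Real.sqrt (2 * (b₁ β ^ 2 + b₂ β ^ 2 + b₃ β ^ 2 + b₄ β ^ 2)) ^ 2 ≤ a * lam β := by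
  intro a ha
  have ha8 : 0 < a / 8 := by positivity
  filter_upwards [h₁ _ ha8, h₂ _ ha8, h₃ _ ha8, h₄ _ ha8] with β e₁ e₂ e₃ e₄
  rw [Real.sq_sqrt (by positivity)]
  linarith

end Abstract

end Summit.QuantumFields.YangMills.Theorems.FemtoTransferGap.TwoLattice.ConstTube

end
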